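import Summits.HubbardSuperconductivity.HubbardSuperconductivity.Theorems.AnisotropyChordInsertionEntropyJelliumSheet

/-!
# Route `AnisotropyChord` / H0 rotor rung: POINTWISE ALGEBRAIC SCREENING of the two-defect cloud suffices for R8
# (uniform lattice sums on `(ℤ/L)²`) (theory seat `hubbard-h0-rotor-theory-1`, cycle 9, memo ROTOR-THEORY-9 §135(g);
# Sketch9 Part H ported)

* `latWeight L q v = (1 + dist v)^{−q}` (`dist = (L/2π)·|v|_T` the min-image distance in lattice units), its algebra
  (`latWeight_mul`, the cross-term comparison `latWeight_mul_le`), `abs_sheetFun_le` (`|W| ≤ (|c| + 2|β|)(1+dist)^{−1}`);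
* **`sum_latWeight_le`** : for `q > 2`, `Σ_{z ∈ (ℤ/L)²} (1 + dist z)^{−q} ≤ S(q)` uniformly in `L` (fold each coordinate,
  factorise, compare with `ζ(q/2)`; tree `rpow_neg_torusNorm_le_prod`, Literature `sum_zmod_le_of_valMinAbs`);
* **R8b** `SheetDefectScreening β c` (OPEN; typed): `|condOcc(z) − m| ≤ C[(1+d(z,x))^{−1−ε} + (1+d(z,y))^{−1−ε}]` for some
  `ε > 0` (Debye–Hückel: exponent 3) — algebraic decay of the three-point truncated correlation of the 2D lattice gas with
  pair potential `β/r`, the typed FIRST LEMMA of the proposed R8 rung;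
* `sheetWeightedScreening_of_defectScreening` (R8b ⇒ R8a) and `jelliumSheetEntropyBound_of_defectScreening`
  (R8b ⇒ R8), both PROVED.
Nothing here claims R8b.
-/

set_option linter.dupNamespace false

noncomputable section

open Finset
open Literature.Probability.LatticeModels

namespace Summit.HubbardSuperconductivity.HubbardSuperconductivity.Theorems.AnisotropyChord.InsertionEntropy

section JelliumScreening

/-- Lattice weight `(1 + dist)^{−q}`, `dist = (L/2π)·|v|_T` = min-image Euclidean distance in lattice units.
(theory seat `hubbard-h0-rotor-theory-1`, memo ROTOR-THEORY-9 §135) [folklore] -/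
def latWeight (L : ℕ) [NeZero L] (q : ℝ) (v : TorusSite 2 L) : ℝ :=
  (1 + (L : ℝ) / (2 * Real.pi) * torusNorm L v) ^ (-q)

/-- The lattice distance is non-negative. [folklore] -/
theorem latDist_nonneg (L : ℕ) [NeZero L] (v : TorusSite 2 L) :
    0 ≤ (L : ℝ) / (2 * Real.pi) * torusNorm L v := by
  have hL : (0 : ℝ) < (L : ℝ) := by exact_mod_cast Nat.pos_of_ne_zero (NeZero.ne L)
  exact mul_nonneg (by positivity) (torusNorm_nonneg v)

/-- A non-zero torus vector has lattice length at least `1`. [folklore] -/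
theorem one_le_latDist_of_ne_zero (L : ℕ) [NeZero L] {v : TorusSite 2 L} (hv : v ≠ 0) :
    1 ≤ (L : ℝ) / (2 * Real.pi) * torusNorm L v := by
  have hL : (0 : ℝ) < (L : ℝ) := by exact_mod_cast Nat.pos_of_ne_zero (NeZero.ne L)
  have hq := one_le_sum_natAbs_valMinAbs_sq hv
  rw [torusNorm_eq]
  have e : (L : ℝ) / (2 * Real.pi) * (2 * Real.pi / (L : ℝ)
      * Real.sqrt (∑ i, (((v i).valMinAbs.natAbs : ℕ) : ℝ) ^ 2))
      = Real.sqrt (∑ i, (((v i).valMinAbs.natAbs : ℕ) : ℝ) ^ 2) := by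
    field_simp
  rw [e, ← Real.sqrt_one]
  exact Real.sqrt_le_sqrt hq

/-- `|0|_T = 0`. [folklore] -/
theorem torusNorm_zero_eq (L : ℕ) [NeZero L] : torusNorm L (0 : TorusSite 2 L) = 0 := by
  unfold torusNorm; simp

/-- `latWeight L q 0 = 1`. [folklore] -/
theorem latWeight_zero (L : ℕ) [NeZero L] (q : ℝ) : latWeight L q (0 : TorusSite 2 L) = 1 := by
  unfold latWeight; rw [torusNorm_zero_eq, mul_zero, add_zero, Real.one_rpow]

/-- `latWeight ≥ 0`. [folklore] -/
theorem latWeight_nonneg (L : ℕ) [NeZero L] (q : ℝ) (v : TorusSite 2 L) : 0 ≤ latWeight L q v := by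
  unfold latWeight; exact Real.rpow_nonneg (by linarith [latDist_nonneg L v]) _

/-- Closer ⇒ heavier (for `q ≥ 0`). [folklore] -/
theorem latWeight_le_of_dist_le (L : ℕ) [NeZero L] {q : ℝ} (hq : 0 ≤ q) {u v : TorusSite 2 L}
    (h : (L : ℝ) / (2 * Real.pi) * torusNorm L u ≤ (L : ℝ) / (2 * Real.pi) * torusNorm L v) :
    latWeight L q v ≤ latWeight L q u := by
  unfold latWeight
  exact Real.rpow_le_rpow_of_nonpos (by linarith [latDist_nonneg L u]) (by linarith) (by linarith)

/-- Exponents add. [folklore] -/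
theorem latWeight_mul (L : ℕ) [NeZero L] (q₁ q₂ : ℝ) (v : TorusSite 2 L) :
    latWeight L q₁ v * latWeight L q₂ v = latWeight L (q₁ + q₂) v := by
  unfold latWeight
  rw [← Real.rpow_add (by linarith [latDist_nonneg L v])]
  congr 1; ring

/-- The cross term: `(1+D_u)^{−q₁}(1+D_v)^{−q₂} ≤ (1+D_u)^{−(q₁+q₂)} + (1+D_v)^{−(q₁+q₂)}` (compare `D_u`, `D_v`). [folklore] -/
theorem latWeight_mul_le (L : ℕ) [NeZero L] {q₁ q₂ : ℝ} (hq₁ : 0 ≤ q₁) (hq₂ : 0 ≤ q₂) (u v : TorusSite 2 L) :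
    latWeight L q₁ u * latWeight L q₂ v ≤ latWeight L (q₁ + q₂) u + latWeight L (q₁ + q₂) v := by
  rcases le_total ((L : ℝ) / (2 * Real.pi) * torusNorm L u) ((L : ℝ) / (2 * Real.pi) * torusNorm L v)
    with h | h
  · have h1 : latWeight L q₂ v ≤ latWeight L q₂ u := latWeight_le_of_dist_le L hq₂ h
    calc latWeight L q₁ u * latWeight L q₂ v ≤ latWeight L q₁ u * latWeight L q₂ u :=
          mul_le_mul_of_nonneg_left h1 (latWeight_nonneg L q₁ u)
      _ = latWeight L (q₁ + q₂) u := latWeight_mul L q₁ q₂ u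
      _ ≤ latWeight L (q₁ + q₂) u + latWeight L (q₁ + q₂) v :=
          le_add_of_nonneg_right (latWeight_nonneg L _ v)
  · have h1 : latWeight L q₁ u ≤ latWeight L q₁ v := latWeight_le_of_dist_le L hq₁ h
    calc latWeight L q₁ u * latWeight L q₂ v ≤ latWeight L q₁ v * latWeight L q₂ v :=
          mul_le_mul_of_nonneg_right h1 (latWeight_nonneg L q₂ v)
      _ = latWeight L (q₁ + q₂) v := latWeight_mul L q₁ q₂ v
      _ ≤ latWeight L (q₁ + q₂) u + latWeight L (q₁ + q₂) v :=
          le_add_of_nonneg_left (latWeight_nonneg L _ u)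

/-- The sheet kernel is dominated by `(|c| + 2|β|)·(1 + dist)^{−1}`. [folklore] -/
theorem abs_sheetFun_le (L : ℕ) [NeZero L] (β c : ℝ) (v : TorusSite 2 L) :
    |sheetFun L β c v| ≤ (|c| + 2 * |β|) * latWeight L 1 v := by
  by_cases hv : v = 0
  · subst hv
    rw [latWeight_zero, mul_one]
    unfold sheetFun; rw [if_pos rfl]
    linarith [abs_nonneg β]
  · have hD1 := one_le_latDist_of_ne_zero L hv
    set D := (L : ℝ) / (2 * Real.pi) * torusNorm L v with hD
    have hD0 : 0 < D := lt_of_lt_of_le one_pos hD1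
    have hw : latWeight L 1 v = (1 + D)⁻¹ := by
      unfold latWeight; rw [← hD, Real.rpow_neg (by linarith), Real.rpow_one]
    unfold sheetFun; rw [if_neg hv, ← hD, hw, abs_div, abs_of_pos hD0]
    rw [div_le_iff₀ hD0]
    have h1D : (0 : ℝ) < 1 + D := by linarith
    have key : |β| * (1 + D) ≤ (|c| + 2 * |β|) * D := by
      nlinarith [abs_nonneg β, abs_nonneg c, hD1]
    calc |β| = |β| * (1 + D) * (1 + D)⁻¹ := by field_simp
      _ ≤ (|c| + 2 * |β|) * D * (1 + D)⁻¹ :=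
          mul_le_mul_of_nonneg_right key (inv_nonneg.mpr h1D.le)
      _ = (|c| + 2 * |β|) * (1 + D)⁻¹ * D := by ring

/-- Translation invariance of lattice sums of the weight. [folklore] -/
theorem sum_latWeight_sub (L : ℕ) [NeZero L] (q : ℝ) (x : TorusSite 2 L) :
    ∑ z, latWeight L q (z - x) = ∑ z, latWeight L q z :=
  Fintype.sum_equiv (Equiv.subRight x) _ _ (fun _ => rfl)

/-- **UNIFORM LATTICE SUM:** for `q > 2`, `Σ_{z ∈ (ℤ/L)²} (1 + dist(z))^{−q} ≤ S(q)` uniformly in `L`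
(fold each coordinate, factorise, compare with `ζ(q/2)`). Theory seat memo ROTOR-THEORY-9 §135(g). [folklore] -/
theorem sum_latWeight_le {q : ℝ} (hq : 2 < q) :
    ∃ S : ℝ, ∀ L : ℕ, ∀ [NeZero L], ∑ z : TorusSite 2 L, latWeight L q z ≤ S := by
  have hγ : 1 < q / 2 := by linarith
  have hq0 : 0 ≤ q := by linarith
  have hsum : Summable (fun n : ℕ => ((n : ℝ) ^ (q / 2))⁻¹) := Real.summable_nat_rpow_inv.mpr hγ
  set Z : ℝ := ∑' n : ℕ, ((n : ℝ) ^ (q / 2))⁻¹ with hZ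
  refine ⟨(1 + 2 * Z) ^ 2, fun L _ => ?_⟩
  have hL : (0 : ℝ) < (L : ℝ) := by exact_mod_cast Nat.pos_of_ne_zero (NeZero.ne L)
  set h : ℕ → ℝ := fun m => ((max m 1 : ℕ) : ℝ) ^ (-(q / 2)) with hh
  have hh0 : ∀ m, 0 ≤ h m := fun m => Real.rpow_nonneg (Nat.cast_nonneg _) _
  -- pointwise domination by the product weight
  have hpt : ∀ z : TorusSite 2 L, latWeight L q z ≤ ∏ i, h ((z i).valMinAbs.natAbs) := by
    intro z
    by_cases hz : z = 0
    · subst hz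
      rw [latWeight_zero]
      have : ∏ i : Fin 2, h (((0 : TorusSite 2 L) i).valMinAbs.natAbs) = 1 := by
        simp [hh]
      rw [this]
    · have hD1 := one_le_latDist_of_ne_zero L hz
      have hD0 : 0 < (L : ℝ) / (2 * Real.pi) * torusNorm L z := lt_of_lt_of_le one_pos hD1
      have htn : 0 < torusNorm L z := torusNorm_pos hz
      have hc : (0 : ℝ) < (L : ℝ) / (2 * Real.pi) := by positivity
      calc latWeight L q z ≤ ((L : ℝ) / (2 * Real.pi) * torusNorm L z) ^ (-q) := by
            unfold latWeight
            exact Real.rpow_le_rpow_of_nonpos hD0 (by linarith) (by linarith)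
        _ = ((L : ℝ) / (2 * Real.pi)) ^ (-q) * (torusNorm L z) ^ (-q) :=
            Real.mul_rpow hc.le htn.le
        _ ≤ ((L : ℝ) / (2 * Real.pi)) ^ (-q)
              * (((L : ℝ) / (2 * Real.pi)) ^ q * ∏ i, h ((z i).valMinAbs.natAbs)) :=
            mul_le_mul_of_nonneg_left (rpow_neg_torusNorm_le_prod hq0 hz) (Real.rpow_nonneg hc.le _)
        _ = ∏ i, h ((z i).valMinAbs.natAbs) := by
            rw [← mul_assoc, Real.rpow_neg hc.le, inv_mul_cancel₀ (Real.rpow_pos_of_pos hc q).ne', one_mul]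
  -- factorise
  have hf : ∑ z : TorusSite 2 L, ∏ i, h ((z i).valMinAbs.natAbs)
      = (∑ a : ZMod L, h a.valMinAbs.natAbs) ^ 2 := by
    have : ∑ z : TorusSite 2 L, ∏ i, h ((z i).valMinAbs.natAbs)
        = ∏ _i : Fin 2, ∑ a : ZMod L, h a.valMinAbs.natAbs := by
      rw [Finset.prod_univ_sum]
      simp [Fintype.piFinset_univ]
    rw [this, Finset.prod_const, Finset.card_univ, Fintype.card_fin]
  -- the folded one-dimensional factor is bounded by `1 + 2ζ(q/2)`
  have h1d : ∑ a : ZMod L, h a.valMinAbs.natAbs ≤ 1 + 2 * Z := by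
    have hfold := sum_zmod_le_of_valMinAbs L h hh0
    have h0 : h 0 = 1 := by simp [hh]
    have hIcc : ∑ j ∈ Finset.Icc 1 (L / 2), h j ≤ Z := by
      have e : ∑ j ∈ Finset.Icc 1 (L / 2), h j = ∑ j ∈ Finset.Icc 1 (L / 2), ((j : ℝ) ^ (q / 2))⁻¹ := by
        refine Finset.sum_congr rfl fun j hj => ?_
        rw [Finset.mem_Icc] at hj
        simp only [hh, Nat.max_eq_left hj.1]
        rw [Real.rpow_neg (Nat.cast_nonneg _)]
      rw [e, hZ]
      exact hsum.sum_le_tsum _ (fun j _ => inv_nonneg.mpr (Real.rpow_nonneg (Nat.cast_nonneg _) _))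
    rw [h0] at hfold
    linarith
  have hS0 : 0 ≤ ∑ a : ZMod L, h a.valMinAbs.natAbs := Finset.sum_nonneg fun a _ => hh0 _
  calc ∑ z : TorusSite 2 L, latWeight L q z ≤ ∑ z : TorusSite 2 L, ∏ i, h ((z i).valMinAbs.natAbs) :=
        Finset.sum_le_sum fun z _ => hpt z
    _ = (∑ a : ZMod L, h a.valMinAbs.natAbs) ^ 2 := hf
    _ ≤ (1 + 2 * Z) ^ 2 := pow_le_pow_left₀ hS0 h1d 2

/-- **R8b — `SheetDefectScreening` (POINTWISE ALGEBRAIC SCREENING** of the two-defect cloud; OPEN):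
`|condOcc(z) − m| ≤ C[(1+d(z,x))^{−1−ε} + (1+d(z,y))^{−1−ε}]` for SOME `ε > 0`, uniformly in `L` and `x ≠ y`
(Debye–Hückel: exponent 3, i.e. `ε = 2`).  The typed first lemma of the proposed R8 rung: algebraic decay of the
three-point truncated correlation `ρ(z | x occupied, y empty) − ρ̄` in the 2D lattice gas with pair potential `β/r`.
[conjecture: theory seat hubbard-h0-rotor-theory-1, cycle 9, 2026-08-28 — memo ROTOR-THEORY-9 §135(g) (R8b; OPEN)] -/
def SheetDefectScreening (β c : ℝ) : Prop :=
  ∃ C ε : ℝ, 0 < ε ∧ ∀ L : ℕ, ∀ [NeZero L], ∀ x y : TorusSite 2 L, x ≠ y → ∃ m : ℝ, ∀ z : TorusSite 2 L,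
    |condOcc (jastrowAmp (sheetKernel L β c)) x y z - m|
      ≤ C * (latWeight L (1 + ε) (z - x) + latWeight L (1 + ε) (z - y))

/-- **R8a ⟸ R8b (PROVED):** any summable-against-`1/r` algebraic decay of the conditioned cloud gives the weighted
screening bound, by the cross-term comparison and the uniform lattice sum `Σ (1+dist)^{−2−ε} ≤ S`. Theory seat memo
ROTOR-THEORY-9 §135(g). [folklore] -/
theorem sheetWeightedScreening_of_defectScreening (β c : ℝ) :
    SheetDefectScreening β c → SheetWeightedScreening β c := by
  rintro ⟨C, ε, hε, h⟩
  obtain ⟨S, hS⟩ := sum_latWeight_le (q := 2 + ε) (by linarith)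
  set C' : ℝ := max C 0 with hC'
  have hC'0 : 0 ≤ C' := le_max_right _ _
  set K : ℝ := |c| + 2 * |β| with hK
  have hK0 : 0 ≤ K := by positivity
  refine ⟨3 * C' * K * (S + S), fun L _ x y hxy => ?_⟩
  obtain ⟨m, hm⟩ := h L x y hxy
  refine ⟨m, ?_⟩
  -- abbreviations
  set A : TorusSite 2 L → TorusSite 2 L → ℝ := fun u z => latWeight L (1 + ε) (z - u) with hA
  set B : TorusSite 2 L → TorusSite 2 L → ℝ := fun u z => latWeight L 1 (z - u) with hB
  set Q : TorusSite 2 L → TorusSite 2 L → ℝ := fun u z => latWeight L (2 + ε) (z - u) with hQ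
  have hδ : ∀ z, |condOcc (jastrowAmp (sheetKernel L β c)) x y z - m| ≤ C' * (A x z + A y z) := by
    intro z
    refine (hm z).trans ?_
    exact mul_le_mul_of_nonneg_right (le_max_left _ _)
      (add_nonneg (latWeight_nonneg L _ _) (latWeight_nonneg L _ _))
  have hW : ∀ z, |sheetFun L β c (z - y)| + |sheetFun L β c (z - x)| ≤ K * (B x z + B y z) := by
    intro z
    have h1 := abs_sheetFun_le L β c (z - y)
    have h2 := abs_sheetFun_le L β c (z - x)
    simp only [hB]; linarith
  -- the pointwise product bound `(A_x + A_y)(B_x + B_y) ≤ 3 (Q_x + Q_y)`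
  have hcross : ∀ z, (A x z + A y z) * (B x z + B y z) ≤ 3 * (Q x z + Q y z) := by
    intro z
    have e1 : (1 + ε) + 1 = 2 + ε := by ring
    have hxx : A x z * B x z = Q x z := by simp only [hA, hB, hQ]; rw [latWeight_mul, e1]
    have hyy : A y z * B y z = Q y z := by simp only [hA, hB, hQ]; rw [latWeight_mul, e1]
    have hxy' : A x z * B y z ≤ Q x z + Q y z := by
      simp only [hA, hB, hQ]; rw [← e1]
      exact latWeight_mul_le L (by linarith) zero_le_one (z - x) (z - y)
    have hyx' : A y z * B x z ≤ Q y z + Q x z := by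
      simp only [hA, hB, hQ]; rw [← e1]
      exact latWeight_mul_le L (by linarith) zero_le_one (z - y) (z - x)
    nlinarith [hxx, hyy, hxy', hyx', latWeight_nonneg L (2 + ε) (z - x), latWeight_nonneg L (2 + ε) (z - y)]
  -- termwise estimate
  have hterm : ∀ z, |condOcc (jastrowAmp (sheetKernel L β c)) x y z - m|
        * (|sheetFun L β c (z - y)| + |sheetFun L β c (z - x)|)
      ≤ 3 * C' * K * (Q x z + Q y z) := by
    intro z
    have hb0 : 0 ≤ C' * (A x z + A y z) :=
      mul_nonneg hC'0 (add_nonneg (latWeight_nonneg L _ _) (latWeight_nonneg L _ _))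
    calc |condOcc (jastrowAmp (sheetKernel L β c)) x y z - m|
            * (|sheetFun L β c (z - y)| + |sheetFun L β c (z - x)|)
          ≤ (C' * (A x z + A y z)) * (K * (B x z + B y z)) :=
            mul_le_mul (hδ z) (hW z) (add_nonneg (abs_nonneg _) (abs_nonneg _)) hb0
      _ = C' * K * ((A x z + A y z) * (B x z + B y z)) := by ring
      _ ≤ C' * K * (3 * (Q x z + Q y z)) :=
            mul_le_mul_of_nonneg_left (hcross z) (mul_nonneg hC'0 hK0)
      _ = 3 * C' * K * (Q x z + Q y z) := by ring
  -- sum, translate, and use the uniform lattice sum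
  have hsumQ : ∑ z, (Q x z + Q y z) ≤ S + S := by
    rw [Finset.sum_add_distrib]
    simp only [hQ]
    rw [sum_latWeight_sub L (2 + ε) x, sum_latWeight_sub L (2 + ε) y]
    exact add_le_add (hS L) (hS L)
  calc ∑ z, |condOcc (jastrowAmp (sheetKernel L β c)) x y z - m|
          * (|sheetFun L β c (z - y)| + |sheetFun L β c (z - x)|)
        ≤ ∑ z, 3 * C' * K * (Q x z + Q y z) := Finset.sum_le_sum fun z _ => hterm z
    _ = 3 * C' * K * ∑ z, (Q x z + Q y z) := by rw [Finset.mul_sum]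
    _ ≤ 3 * C' * K * (S + S) := mul_le_mul_of_nonneg_left hsumQ (by positivity)

/-- **THE JASTROW–SHEET CHAIN (PROVED):** pointwise algebraic screening of the conditioned two-defect cloud in the
classical lattice `1/r` gas ⇒ weighted screening ⇒ `JelliumSheetEntropyBound`. Theory seat memo ROTOR-THEORY-9 §135(g). [folklore] -/
theorem jelliumSheetEntropyBound_of_defectScreening (β c : ℝ) :
    SheetDefectScreening β c → JelliumSheetEntropyBound β c :=
  fun h => jelliumSheetEntropyBound_of_weightedScreening β c (sheetWeightedScreening_of_defectScreening β c h)

end JelliumScreening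

end Summit.HubbardSuperconductivity.HubbardSuperconductivity.Theorems.AnisotropyChord.InsertionEntropy
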